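import Summits.QuantumFields.YangMills.Theorems.UnitScaleTiltProp7SectET3GaugeProjectorT3
import HarnessLib

/-!
# Route `UnitScaleTilt`, crux «MinimiserStabilityRegPr» (stmt-QuantumFields-19200, stub EX) ∕ (O″χ) B0 (stmt-QuantumFields-20520), node N06(d = 3), route (α) —
# LAYER 0, ROWS OF BRICK L0c (def-free sibling of `UnitScaleTiltProp7SectET3GaugeProjectorT3`, ★★OWNER ACK 32 (q3)): **THE INTRINSIC GAUGE PROJECTOR `R_S(U₀)` IS AN
# ORTHOGONAL PROJECTION ONTO `Δ^η_{U₀} N_S(U₀)`** — symmetric, idempotent, range `= Δ^η_{U₀}N_S`, fixes `Δ^η_{U₀}N_S` — **AND THE AVERAGES ARE INVARIANT UNDER THE RESIDUAL GAUGE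
# ALGEBRA** (`Q(U₀)(D_{U₀}λ) = 0` for `λ ∈ N_S(U₀)`, [Balaban1985BackgroundPropagators] (3.115) p.418, by construction): the two structural inputs of the (3.124) mechanism
# (`B6Eq231`) that brick L0e consumes

Cell `ym-inputs` (desk `pub/ym-inputs`, INPUT-LIST.md v6 §4 row p01; memo `pub/ym-inputs/DEFINER-MEMO-T3.md` §2).  THEOREMS ONLY (0 `def`, 0 `sorry`); `--supports stmt-QuantumFields-20520
--as helper`; count-neutral.  YM₃ on T³ is ladder rung R3, NOT the Clay problem; nothing here is a claim about a stub, a crux, d = 4 or the mass gap.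

THE PRINT.  [Balaban1985BackgroundPropagators] p. 394: *«R = R(U) is an orthogonal projection in the Hilbert space L²(Ω₀, 𝔤) onto the subspace ℛ = Δ^η_U N(Q′) (3.21) … For an arbitrary
function f ∈ L²(Ω₀, 𝔤) we have Rf = Δ^η_U λ₀ where λ₀ is a minimum … (3.22)»*; p. 418: *«they imply that the averages QA are invariant with respect to gauge transformations λ satisfying
Q′λ = 0, i.e. λ ∈ N(Q′)»*.

WHAT IS PROVED (all from lit-balaban's `B11Eq103H1Complex.projR_*` through L0c's `RS_eq_projR`): `QL2_DL2_eq_zero_of_mem_NS` ((3.115) on `N_S`), `mem_NS_of_DL2_eq_zero` (`ker D_{U₀} ≤ N_S`),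
`RS_isSymmetric` («orthogonal»), `exists_mem_NS_RS_eq` ((3.22): `R_S f = Δ^η_{U₀}λ₀`, `λ₀ ∈ N_S`), `RS_apply_covLapSite_of_mem` ((3.21): `R_S` fixes `Δ^η_{U₀}N_S`), `RS_RS` (`R_S² = R_S`),
`RS_apply_eq_self_iff` (the range characterisation), `QL2_DL2_of_RS_eq` (every `R_S f` is `Δλ` with `Q(Dλ) = 0` — the shape L0e's (3.124) row reads).
HONEST SCOPE.  Finite-dimensional Hilbert-space facts about a definition; no estimate; nothing of print asserted.

References: T. Bałaban, CMP **99** (1985) 389–434 [Balaban1985BackgroundPropagators] ((3.21)–(3.22) p.394, (3.115) p.418, (3.124) p.420).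
-/

set_option autoImplicit false

noncomputable section

open scoped InnerProductSpace ComplexConjugate Matrix.Norms.L2Operator

namespace Summit.QuantumFields.YangMills.Theorems.Prop7SectET3GaugeProjector

open Literature.MathematicalPhysics.QuantumFieldTheory.Balaban1983to89
open Literature.MathematicalPhysics.QuantumFieldTheory.Balaban1983to89.T3ContinuumYM3Torus
open B9Eq311L2Pairing (WL2)
open B11Eq103H1Complex (SiteL2K BondL2K projR projR_isSymmetric exists_ker_projR_eq projR_apply_of_ker projR_projR)
open Summit.QuantumFields.YangMills.Theorems.Prop7SectET3Transport (periodsT3)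
open Summit.QuantumFields.YangMills.Theorems.Prop7SectET3HilbertLetters (W₂ QL2 DL2 covLapSite)

variable {F : T3Family} {n K : ℕ} {h : n ≤ K} {c₀ cB : ℝ} [Fact (0 < c₀)]

/-- **(3.115) ON THE RESIDUAL GAUGE ALGEBRA, BY CONSTRUCTION: `Q(U₀)(D_{U₀}λ) = 0` for `λ ∈ N_S(U₀)`** («the averages QA are invariant with respect to gauge transformations
λ ∈ N(Q′)», p. 418). [cite: Balaban1985BackgroundPropagators, (3.115) p.418] -/
theorem QL2_DL2_eq_zero_of_mem_NS (U₀ : GaugeField (F.P K) 0 (Matrix.specialUnitaryGroup (Fin 2) ℂ)) {l : SiteL2K ℂ 3 (periodsT3 F K) c₀ W₂}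
    (hl : l ∈ NS F n K h c₀ cB U₀) : QL2 F n K h c₀ cB U₀ (DL2 F n K c₀ U₀ l) = 0 :=
  (mem_NS_iff U₀ l).1 hl

/-- The covariantly constant gauge parameters are residual: `D_{U₀}λ = 0 ⇒ λ ∈ N_S(U₀)` (so no «mean-free» cut is needed in the definition: `Δ^η_{U₀} = D*D` kills them).
[cite: Balaban1985BackgroundPropagators, (3.21) p.394] -/
theorem mem_NS_of_DL2_eq_zero (U₀ : GaugeField (F.P K) 0 (Matrix.specialUnitaryGroup (Fin 2) ℂ)) {l : SiteL2K ℂ 3 (periodsT3 F K) c₀ W₂}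
    (hl : DL2 F n K c₀ U₀ l = 0) : l ∈ NS F n K h c₀ cB U₀ := by
  rw [mem_NS_iff, hl, map_zero]

/-- **`R_S(U₀)` IS SYMMETRIC** («orthogonal projection», (3.21)). [cite: Balaban1985BackgroundPropagators, (3.21) p.394] -/
theorem RS_isSymmetric (U₀ : GaugeField (F.P K) 0 (Matrix.specialUnitaryGroup (Fin 2) ℂ)) : (RS F n K h c₀ cB U₀).IsSymmetric := by
  rw [RS_eq_projR]
  exact projR_isSymmetric _ _

/-- **(3.22): `R_S f = Δ^η_{U₀}λ₀` FOR SOME `λ₀ ∈ N_S(U₀)`** — the range of `R_S` is `Δ^η_{U₀}N_S`. [cite: Balaban1985BackgroundPropagators, (3.22) p.394] -/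
theorem exists_mem_NS_RS_eq (U₀ : GaugeField (F.P K) 0 (Matrix.specialUnitaryGroup (Fin 2) ℂ)) (f : SiteL2K ℂ 3 (periodsT3 F K) c₀ W₂) :
    ∃ l ∈ NS F n K h c₀ cB U₀, RS F n K h c₀ cB U₀ f = covLapSite F n K c₀ U₀ l := by
  obtain ⟨l, hl, hf⟩ := exists_ker_projR_eq (covLapSite F n K c₀ U₀) (QDS F n K h c₀ cB U₀) f
  exact ⟨l, LinearMap.mem_ker.2 hl, by rw [RS_eq_projR, hf]⟩

/-- **(3.21): `R_S` FIXES `Δ^η_{U₀}N_S(U₀)`** — `R_S(Δ^η_{U₀}λ) = Δ^η_{U₀}λ` for `λ ∈ N_S`. [cite: Balaban1985BackgroundPropagators, (3.21) p.394] -/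
theorem RS_apply_covLapSite_of_mem (U₀ : GaugeField (F.P K) 0 (Matrix.specialUnitaryGroup (Fin 2) ℂ)) {l : SiteL2K ℂ 3 (periodsT3 F K) c₀ W₂}
    (hl : l ∈ NS F n K h c₀ cB U₀) : RS F n K h c₀ cB U₀ (covLapSite F n K c₀ U₀ l) = covLapSite F n K c₀ U₀ l := by
  rw [RS_eq_projR]
  exact projR_apply_of_ker _ _ (LinearMap.mem_ker.1 hl)

/-- **`R_S² = R_S`** (a projection). [cite: Balaban1985BackgroundPropagators, (3.21) p.394] -/
theorem RS_RS (U₀ : GaugeField (F.P K) 0 (Matrix.specialUnitaryGroup (Fin 2) ℂ)) (x : SiteL2K ℂ 3 (periodsT3 F K) c₀ W₂) :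
    RS F n K h c₀ cB U₀ (RS F n K h c₀ cB U₀ x) = RS F n K h c₀ cB U₀ x := by
  rw [RS_eq_projR]
  exact projR_projR _ _ x

/-- THE RANGE CHARACTERISATION: `R_S f = f ↔ f = Δ^η_{U₀}λ` for some `λ ∈ N_S` («f from the space R(U₀)», [Balaban1985RegularSpaces] (1.146)). [cite: Balaban1985BackgroundPropagators, (3.21)–(3.22) p.394] -/
theorem RS_apply_eq_self_iff (U₀ : GaugeField (F.P K) 0 (Matrix.specialUnitaryGroup (Fin 2) ℂ)) (f : SiteL2K ℂ 3 (periodsT3 F K) c₀ W₂) :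
    RS F n K h c₀ cB U₀ f = f ↔ ∃ l ∈ NS F n K h c₀ cB U₀, f = covLapSite F n K c₀ U₀ l := by
  constructor
  · intro hf
    obtain ⟨l, hl, hfl⟩ := exists_mem_NS_RS_eq U₀ f
    exact ⟨l, hl, by rw [← hf, hfl]⟩
  · rintro ⟨l, hl, rfl⟩
    exact RS_apply_covLapSite_of_mem U₀ hl

/-- **THE SHAPE THE (3.124) ROW READS**: for every `f`, `R_S f = D*_{U₀}D_{U₀}λ₀` with `Q(U₀)(D_{U₀}λ₀) = 0` — i.e. the `B6Eq231` inputs «`R` maps into `ΔN`» and «`Q∘D = 0` on `N`» hold for `R_S`, `N_S`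
simultaneously. [cite: Balaban1985BackgroundPropagators, (3.124) p.420, (3.115) p.418] -/
theorem QL2_DL2_of_RS_eq (U₀ : GaugeField (F.P K) 0 (Matrix.specialUnitaryGroup (Fin 2) ℂ)) (f : SiteL2K ℂ 3 (periodsT3 F K) c₀ W₂) :
    ∃ l : SiteL2K ℂ 3 (periodsT3 F K) c₀ W₂, QL2 F n K h c₀ cB U₀ (DL2 F n K c₀ U₀ l) = 0 ∧ RS F n K h c₀ cB U₀ f = covLapSite F n K c₀ U₀ l := by
  obtain ⟨l, hl, hfl⟩ := exists_mem_NS_RS_eq U₀ f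
  exact ⟨l, QL2_DL2_eq_zero_of_mem_NS U₀ hl, hfl⟩

end Summit.QuantumFields.YangMills.Theorems.Prop7SectET3GaugeProjector

end
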